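import Literature.NumberTheory.EllipticCurves.PadicSeriesEvaluation
import HarnessLib

/-!
# `p`-adic evaluation of integral power series in finitely many variables

Trunk T-NT-EC (Literature/NumberTheory/EllipticCurves); the many-variable companion of
`PadicSeriesEvaluation.lean` (which treats one variable and the pair `u = X 0, v = X 1`). For a
finite index type `σ`, `F ∈ ℚ_p⟦σ⟧` and a point `pt : σ → ℚ_p` we define
`padicEvalMv F pt = Σ'_d F_d ∏ₛ (pt s)^{d s}` (a `tsum`, junk `0` off the domain of summability)
and prove, for `F` integral (`IsPadicInt`) and `‖pt s‖ < 1`, that it is Mathlib's topological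
evaluation into `ℤ_p` (`padicEvalMv_eq_coe_eval₂`); hence it is a ring homomorphism in `F` and
COMMUTES WITH SUBSTITUTION (`padicEvalMv_subst`, `padicEvalMv_powerSeries_subst`), by the
`ℤ_p`-coefficient compatibility `padicInt_eval₂_subst` of `PadicSeriesEvaluation.lean`.
`padicEval₂` is the case `σ = Fin 2` (`padicEval₂_eq_padicEvalMv`). This is the setting in which
identities of the three-variable kind (associativity of a formal group law) are evaluated.

## References

* N. Bourbaki, *Algèbre*, Ch. IV §4 no. 3; Silverman AEC IV.1–IV.2 (convergence of the series
  of the formal group on `𝓜 × 𝓜`).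
-/

noncomputable section

open PowerSeries

namespace Literature.NumberTheory.EllipticCurves

variable {p : ℕ} [Fact p.Prime] {σ : Type*} [Fintype σ]

/-- **`F(pt) = Σ'_d F_d ∏ₛ (pt s)^{d s} ∈ ℚ_p`** for `F ∈ ℚ_p⟦σ⟧`, `σ` finite (a `tsum`; junk `0`
off the domain of summability). [Silverman AEC IV.1] [folklore] -/
def padicEvalMv (F : MvPowerSeries σ ℚ_[p]) (pt : σ → ℚ_[p]) : ℚ_[p] :=
  ∑' d : σ →₀ ℕ, MvPowerSeries.coeff d F * d.prod fun s e => pt s ^ e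

/-- Mathlib's evaluation of `ℤ_p⟦σ⟧` at a point of the open unit polydisc, as a ring homomorphism.
[folklore] -/
abbrev evalHomMv (pt : σ → ℤ_[p]) (hpt : ∀ s, ‖pt s‖ < 1) : MvPowerSeries σ ℤ_[p] →+* ℤ_[p] :=
  MvPowerSeries.eval₂Hom (φ := RingHom.id ℤ_[p]) continuous_id (padicInt_mvHasEval hpt)

/-- `evalHomMv` is Mathlib's `MvPowerSeries.eval₂`. [folklore] -/
theorem evalHomMv_apply (pt : σ → ℤ_[p]) (hpt : ∀ s, ‖pt s‖ < 1) (G : MvPowerSeries σ ℤ_[p]) :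
    evalHomMv pt hpt G = MvPowerSeries.eval₂ (RingHom.id ℤ_[p]) pt G := by
  rw [evalHomMv, MvPowerSeries.coe_eval₂Hom]

/-- **Bridge**: for `G ∈ ℤ_p⟦σ⟧` and a point of the open unit polydisc, `padicEvalMv` is Mathlib's
`MvPowerSeries.eval₂` into `ℤ_p`. [folklore] -/
theorem padicEvalMv_map (G : MvPowerSeries σ ℤ_[p]) {pt : σ → ℤ_[p]} (hpt : ∀ s, ‖pt s‖ < 1) :
    padicEvalMv (G.map PadicInt.Coe.ringHom) (fun s => (pt s : ℚ_[p])) =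
      (evalHomMv pt hpt G : ℤ_[p]) := by
  have h := MvPowerSeries.hasSum_eval₂ (φ := RingHom.id ℤ_[p]) continuous_id
    (padicInt_mvHasEval hpt) G
  have h' := h.map PadicInt.Coe.ringHom.toAddMonoidHom continuous_subtype_val
  unfold padicEvalMv
  have hf : (fun d : σ →₀ ℕ => MvPowerSeries.coeff d (G.map PadicInt.Coe.ringHom) *
      d.prod fun s e => (pt s : ℚ_[p]) ^ e) =
      (⇑PadicInt.Coe.ringHom.toAddMonoidHom ∘ fun d =>
        (RingHom.id ℤ_[p]) (MvPowerSeries.coeff d G) * d.prod fun s e => pt s ^ e) := by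
    funext d
    simp only [Function.comp_apply, RingHom.id_apply, RingHom.toAddMonoidHom_eq_coe,
      AddMonoidHom.coe_coe, map_mul, mvCoeff_map_coe]
    congr 1
    simp [Finsupp.prod]
  rw [hf, h'.tsum_eq, evalHomMv_apply]; rfl

/-- **Bridge, hom-free form** (parallel to `padicEval_eq_coe_eval₂`, `padicEval₂_eq_coe_eval₂`):
`padicEvalMv` of an integral series at a point of the open unit polydisc is Mathlib's
`MvPowerSeries.eval₂` into `ℤ_p`. [folklore] -/
theorem padicEvalMv_eq_coe_eval₂ (G : MvPowerSeries σ ℤ_[p]) {pt : σ → ℤ_[p]}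
    (hpt : ∀ s, ‖pt s‖ < 1) :
    padicEvalMv (G.map PadicInt.Coe.ringHom) (fun s => (pt s : ℚ_[p])) =
      (MvPowerSeries.eval₂ (RingHom.id ℤ_[p]) pt G : ℤ_[p]) := by
  rw [padicEvalMv_map G hpt, evalHomMv_apply]

omit [Fintype σ] in
/-- A point of the open unit polydisc of `ℚ_p` comes from `ℤ_p`. [folklore] -/
theorem exists_coe_pt_of_norm_lt_one {pt : σ → ℚ_[p]} (hpt : ∀ s, ‖pt s‖ < 1) :
    ∃ pt' : σ → ℤ_[p], (fun s => (pt' s : ℚ_[p])) = pt ∧ ∀ s, ‖pt' s‖ < 1 :=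
  ⟨fun s => ⟨pt s, (hpt s).le⟩, rfl, hpt⟩

/-- `padicEval₂` is `padicEvalMv` on `Fin 2`. [folklore] -/
theorem padicEval₂_eq_padicEvalMv (F : MvPowerSeries (Fin 2) ℚ_[p]) (u v : ℚ_[p]) :
    padicEval₂ F u v = padicEvalMv F ![u, v] := by
  unfold padicEval₂ padicEvalMv
  congr 1; funext d
  rw [finsupp_prod_pow_fin_two]; rfl

/-! ### Norm bounds -/

section Bounds

variable {F : MvPowerSeries σ ℚ_[p]} {pt : σ → ℚ_[p]}

/-- **`‖F(pt)‖ ≤ 1`** for `F` integral on the open unit polydisc. [folklore] -/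
theorem norm_padicEvalMv_le_one (hF : IsPadicInt F) (hpt : ∀ s, ‖pt s‖ < 1) :
    ‖padicEvalMv F pt‖ ≤ 1 := by
  obtain ⟨F', rfl⟩ := isPadicInt_iff_exists_map.mp hF
  obtain ⟨pt', rfl, hpt'⟩ := exists_coe_pt_of_norm_lt_one hpt
  rw [padicEvalMv_map F' hpt']; exact PadicInt.norm_le_one _

/-- A monomial of positive degree is small on the open unit polydisc: if `d ≠ 0` then
`‖∏ₛ (pt s)^{d s}‖ ≤ maxₛ ‖pt s‖`. [folklore] -/
theorem norm_prod_pow_le [Nonempty σ] (hpt : ∀ s, ‖pt s‖ < 1) {d : σ →₀ ℕ} (hd : d ≠ 0) :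
    ‖d.prod fun s e => pt s ^ e‖ ≤ Finset.univ.sup' Finset.univ_nonempty fun s => ‖pt s‖ := by
  classical
  obtain ⟨s₀, hs₀⟩ : ∃ s₀, d s₀ ≠ 0 := by
    by_contra h; push Not at h; exact hd (Finsupp.ext h)
  rw [Finsupp.prod_fintype _ _ fun i => pow_zero _, norm_prod,
    ← Finset.mul_prod_erase _ _ (Finset.mem_univ s₀)]
  calc ‖pt s₀ ^ d s₀‖ * ∏ s ∈ Finset.univ.erase s₀, ‖pt s ^ d s‖
      ≤ ‖pt s₀‖ * 1 := by
        apply mul_le_mul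
        · rw [norm_pow]
          exact pow_le_of_le_one (norm_nonneg _) (hpt s₀).le hs₀
        · exact Finset.prod_le_one (fun s _ => norm_nonneg _)
            fun s _ => by rw [norm_pow]; exact pow_le_one₀ (norm_nonneg _) (hpt s).le
        · exact Finset.prod_nonneg fun s _ => norm_nonneg _
        · exact norm_nonneg _
    _ = ‖pt s₀‖ := mul_one _
    _ ≤ _ := Finset.le_sup' (fun s => ‖pt s‖) (Finset.mem_univ s₀)

/-- **`‖F(pt)‖ < 1`** for `F` integral WITHOUT CONSTANT TERM on the open unit polydisc.
[folklore] -/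
theorem norm_padicEvalMv_lt_one (hF : IsPadicInt F) (hF0 : MvPowerSeries.constantCoeff F = 0)
    (hpt : ∀ s, ‖pt s‖ < 1) : ‖padicEvalMv F pt‖ < 1 := by
  classical
  cases isEmpty_or_nonempty σ with
  | inl hσ =>
    -- no variables: `F = C (F 0)` and the value is `F 0 = 0`
    unfold padicEvalMv
    rw [tsum_eq_single 0 fun d hd => ?_]
    · rw [MvPowerSeries.coeff_zero_eq_constantCoeff_apply, hF0, zero_mul, norm_zero]
      exact one_pos
    · exact absurd (Subsingleton.elim d 0) hd
  | inr hσ =>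
    set r := Finset.univ.sup' Finset.univ_nonempty fun s => ‖pt s‖ with hr
    have hr1 : r < 1 := by
      rw [hr, Finset.sup'_lt_iff]; exact fun s _ => hpt s
    have hr0 : 0 ≤ r := (norm_nonneg _).trans (Finset.le_sup' (fun s => ‖pt s‖)
      (Finset.mem_univ (Classical.arbitrary σ)))
    refine lt_of_le_of_lt ?_ hr1
    unfold padicEvalMv
    refine IsUltrametricDist.norm_tsum_le_of_forall_le_of_nonneg hr0 fun d => ?_
    by_cases hd : d = 0
    · subst hd
      rw [MvPowerSeries.coeff_zero_eq_constantCoeff_apply, hF0, zero_mul, norm_zero]; exact hr0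
    · rw [norm_mul]
      calc ‖MvPowerSeries.coeff d F‖ * ‖d.prod fun s e => pt s ^ e‖ ≤ 1 * r := by
            gcongr
            · exact hF d
            · exact norm_prod_pow_le hpt hd
        _ = r := one_mul r

end Bounds

/-! ### Evaluation calculus -/

section Calculus

variable {F G : MvPowerSeries σ ℚ_[p]} {pt : σ → ℚ_[p]}

omit [Fintype σ] in
/-- `Xₛ(pt) = pt s`. [folklore] -/
@[simp] theorem padicEvalMv_X (s : σ) (pt : σ → ℚ_[p]) :
    padicEvalMv (MvPowerSeries.X s : MvPowerSeries σ ℚ_[p]) pt = pt s := by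
  classical
  unfold padicEvalMv
  rw [tsum_eq_single (Finsupp.single s 1) fun d hd => by
    rw [MvPowerSeries.coeff_X, if_neg hd, zero_mul]]
  rw [MvPowerSeries.coeff_X, if_pos rfl, one_mul,
    Finsupp.prod_single_index (h := fun s e => pt s ^ e) (pow_zero _), pow_one]

omit [Fintype σ] in
/-- `(C c)(pt) = c`. [folklore] -/
@[simp] theorem padicEvalMv_C (c : ℚ_[p]) (pt : σ → ℚ_[p]) :
    padicEvalMv (MvPowerSeries.C c : MvPowerSeries σ ℚ_[p]) pt = c := by
  classical
  unfold padicEvalMv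
  rw [tsum_eq_single 0 fun d hd => by rw [MvPowerSeries.coeff_C, if_neg hd, zero_mul]]
  simp

/-- `(F + G)(pt) = F(pt) + G(pt)` (integral `F, G`). [folklore] -/
theorem padicEvalMv_add (hF : IsPadicInt F) (hG : IsPadicInt G) (hpt : ∀ s, ‖pt s‖ < 1) :
    padicEvalMv (F + G) pt = padicEvalMv F pt + padicEvalMv G pt := by
  obtain ⟨F', rfl⟩ := isPadicInt_iff_exists_map.mp hF
  obtain ⟨G', rfl⟩ := isPadicInt_iff_exists_map.mp hG
  obtain ⟨pt', rfl, hpt'⟩ := exists_coe_pt_of_norm_lt_one hpt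
  rw [← map_add, padicEvalMv_map _ hpt', padicEvalMv_map _ hpt', padicEvalMv_map _ hpt', map_add,
    PadicInt.coe_add]

/-- `(-F)(pt) = -F(pt)`. [folklore] -/
theorem padicEvalMv_neg (hF : IsPadicInt F) (hpt : ∀ s, ‖pt s‖ < 1) :
    padicEvalMv (-F) pt = -padicEvalMv F pt := by
  obtain ⟨F', rfl⟩ := isPadicInt_iff_exists_map.mp hF
  obtain ⟨pt', rfl, hpt'⟩ := exists_coe_pt_of_norm_lt_one hpt
  rw [← map_neg, padicEvalMv_map _ hpt', padicEvalMv_map _ hpt', map_neg, PadicInt.coe_neg]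

/-- `(F - G)(pt) = F(pt) - G(pt)`. [folklore] -/
theorem padicEvalMv_sub (hF : IsPadicInt F) (hG : IsPadicInt G) (hpt : ∀ s, ‖pt s‖ < 1) :
    padicEvalMv (F - G) pt = padicEvalMv F pt - padicEvalMv G pt := by
  rw [sub_eq_add_neg, padicEvalMv_add hF hG.neg hpt, padicEvalMv_neg hG hpt, sub_eq_add_neg]

/-- **`(F G)(pt) = F(pt) G(pt)`** (integral `F, G`). [folklore] -/
theorem padicEvalMv_mul (hF : IsPadicInt F) (hG : IsPadicInt G) (hpt : ∀ s, ‖pt s‖ < 1) :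
    padicEvalMv (F * G) pt = padicEvalMv F pt * padicEvalMv G pt := by
  obtain ⟨F', rfl⟩ := isPadicInt_iff_exists_map.mp hF
  obtain ⟨G', rfl⟩ := isPadicInt_iff_exists_map.mp hG
  obtain ⟨pt', rfl, hpt'⟩ := exists_coe_pt_of_norm_lt_one hpt
  rw [← map_mul, padicEvalMv_map _ hpt', padicEvalMv_map _ hpt', padicEvalMv_map _ hpt', map_mul,
    PadicInt.coe_mul]

/-- `(Fⁿ)(pt) = F(pt)ⁿ`. [folklore] -/
theorem padicEvalMv_pow (hF : IsPadicInt F) (hpt : ∀ s, ‖pt s‖ < 1) (n : ℕ) :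
    padicEvalMv (F ^ n) pt = padicEvalMv F pt ^ n := by
  obtain ⟨F', rfl⟩ := isPadicInt_iff_exists_map.mp hF
  obtain ⟨pt', rfl, hpt'⟩ := exists_coe_pt_of_norm_lt_one hpt
  rw [← map_pow, padicEvalMv_map _ hpt', padicEvalMv_map _ hpt', map_pow, PadicInt.coe_pow]

/-- **Evaluation commutes with substitution (many variables)**:
`(F ∘ a)(pt) = F(a₁(pt), …)` for `F ∈ ℤ_p⟦τ⟧`, `a : τ → ℤ_p⟦σ⟧` without constant terms, `pt` in
the open unit polydisc. [Bourbaki, Algèbre IV §4 no. 3] [folklore] -/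
theorem padicEvalMv_subst {τ : Type*} [Fintype τ] {F : MvPowerSeries τ ℚ_[p]}
    {a : τ → MvPowerSeries σ ℚ_[p]} (hF : IsPadicInt F) (ha : ∀ i, IsPadicInt (a i))
    (ha0 : ∀ i, MvPowerSeries.constantCoeff (a i) = 0) (hpt : ∀ s, ‖pt s‖ < 1) :
    padicEvalMv (MvPowerSeries.subst a F) pt = padicEvalMv F fun i => padicEvalMv (a i) pt := by
  have hapt : ∀ i, ‖padicEvalMv (a i) pt‖ < 1 := fun i => norm_padicEvalMv_lt_one (ha i) (ha0 i) hpt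
  obtain ⟨F', rfl⟩ := isPadicInt_iff_exists_map.mp hF
  choose a' ha' using fun i => isPadicInt_iff_exists_map.mp (ha i)
  obtain ⟨pt', rfl, hpt'⟩ := exists_coe_pt_of_norm_lt_one hpt
  have ha'0 : ∀ i, MvPowerSeries.constantCoeff (a' i) = 0 := fun i => by
    apply PadicInt.coe_eq_zero.mp
    have := ha0 i
    rw [← ha' i, MvPowerSeries.constantCoeff_map] at this
    exact this
  have hs : MvPowerSeries.HasSubst a' := MvPowerSeries.hasSubst_of_constantCoeff_zero ha'0
  have hfun : a = fun i => (a' i).map PadicInt.Coe.ringHom := funext fun i => (ha' i).symm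
  have hval : ∀ i, padicEvalMv (a i) (fun s => (pt' s : ℚ_[p])) = (evalHomMv pt' hpt' (a' i) : ℤ_[p]) :=
    fun i => by rw [← ha' i, padicEvalMv_map _ hpt']
  have hapt' : ∀ i, ‖evalHomMv pt' hpt' (a' i)‖ < 1 := fun i => by
    have := hapt i; rwa [hval i] at this
  rw [hfun, ← MvPowerSeries.map_subst hs, padicEvalMv_map _ hpt']
  have hval' : (fun i => padicEvalMv ((fun i => (a' i).map PadicInt.Coe.ringHom) i)
      fun s => (pt' s : ℚ_[p])) = fun i => ((evalHomMv pt' hpt' (a' i) : ℤ_[p]) : ℚ_[p]) := by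
    funext i; exact padicEvalMv_map _ hpt'
  rw [hval', padicEvalMv_map F' hapt', evalHomMv_apply, evalHomMv_apply,
    padicInt_eval₂_subst hs (padicInt_mvHasEval hpt')]
  congr 2
  funext i; rw [evalHomMv_apply]

/-- **Evaluation commutes with substitution into one variable**:
`(f ∘ A)(pt) = f(A(pt))` for `f ∈ ℤ_p⟦X⟧`, `A ∈ ℤ_p⟦σ⟧` without constant term. [folklore] -/
theorem padicEvalMv_powerSeries_subst {f : ℚ_[p]⟦X⟧} {A : MvPowerSeries σ ℚ_[p]}
    (hf : IsPadicInt f) (hA : IsPadicInt A) (hA0 : MvPowerSeries.constantCoeff A = 0)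
    (hpt : ∀ s, ‖pt s‖ < 1) :
    padicEvalMv (f.subst A) pt = padicEval f (padicEvalMv A pt) := by
  have hApt : ‖padicEvalMv A pt‖ < 1 := norm_padicEvalMv_lt_one hA hA0 hpt
  obtain ⟨f', rfl⟩ := isPadicInt_iff_exists_powerSeries_map.mp hf
  obtain ⟨A', rfl⟩ := isPadicInt_iff_exists_map.mp hA
  obtain ⟨pt', rfl, hpt'⟩ := exists_coe_pt_of_norm_lt_one hpt
  have hA'0 : MvPowerSeries.constantCoeff A' = 0 := by
    apply PadicInt.coe_eq_zero.mp
    rw [MvPowerSeries.constantCoeff_map] at hA0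
    exact hA0
  have hAs : PowerSeries.HasSubst A' := PowerSeries.HasSubst.of_constantCoeff_zero hA'0
  rw [padicEvalMv_map A' hpt'] at hApt ⊢
  rw [← PowerSeries.map_subst hAs, padicEvalMv_map _ hpt', padicEval_map _ hApt, evalHomMv_apply,
    evalHom_apply]
  congr 1
  rw [padicInt_eval₂_powerSeries_subst hAs (padicInt_mvHasEval hpt') f', ← evalHomMv_apply pt' hpt']

/-- In particular a one-variable series read in the variable `Xₛ` evaluates to `f(pt s)`.
[folklore] -/
theorem padicEvalMv_subst_X {f : ℚ_[p]⟦X⟧} (hf : IsPadicInt f) (hpt : ∀ s, ‖pt s‖ < 1) (s : σ) :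
    padicEvalMv (f.subst (MvPowerSeries.X s : MvPowerSeries σ ℚ_[p])) pt = padicEval f (pt s) := by
  rw [padicEvalMv_powerSeries_subst hf (IsPadicInt.X s) (MvPowerSeries.constantCoeff_X s) hpt,
    padicEvalMv_X]

omit [Fintype σ] in
/-- The value at the origin is the constant term. [folklore] -/
theorem padicEvalMv_zero (F : MvPowerSeries σ ℚ_[p]) :
    padicEvalMv F (fun _ => 0) = MvPowerSeries.constantCoeff F := by
  classical
  unfold padicEvalMv
  rw [tsum_eq_single 0 fun d hd => ?_]
  · simp
  · obtain ⟨s₀, hs₀⟩ : ∃ s₀, d s₀ ≠ 0 := by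
      by_contra h; push Not at h; exact hd (Finsupp.ext h)
    rw [Finsupp.prod, Finset.prod_eq_zero (Finsupp.mem_support_iff.mpr hs₀) (zero_pow hs₀),
      mul_zero]

end Calculus

end Literature.NumberTheory.EllipticCurves
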